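import Mathlib
import HarnessLib
import Summits.Ventures.LatticeQCDFlow.Scoring.KishESSStdErr

/-!
# An ERROR BAR for the printed ESS column, II: the STUDENTISED CLT
# `√n (Kₙ − 1/M₂)/ŝₙ ⇒ N(0, 1)` — `Kₙ ± z·ŝₙ/√n` has asymptotically exact coverage for the
# population ESS fraction `1/M₂`, everything computed from the printed weights

HONEST FRAMING: exact (Metropolis-corrected) sampling algorithms for lattice gauge theory;
figures of merit are autocorrelation/cost numbers at stated couplings and volumes; no
continuum-physics claim.

Venture `LatticeQCDFlow` (cell pub-lqcd), topic `Scoring`; FANOUT row 4 (`s0-u1-b`, rung S0-B).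
Sequel of `Scoring/KishESSCLT` (`√n (Kₙ − 1/M₂) ⇒ Y/M₂²`, `Y ∼ N(0, σ²_K)`) and
`Scoring/KishESSStdErr` (the plug-in `ŝₙ² → σ²_K/M₂⁴` almost surely), both imported through the
latter.  With `Y = σ_K·Y₁` for a standard normal `Y₁`, Slutsky
(`continuous_comp_prodMk_of_tendstoInMeasure_const`, `g(x, v) = x/√(max(v, s₀/2))`,
`s₀ = σ²_K/M₂⁴ > 0`) gives `g(√n (Kₙ − 1/M₂), ŝₙ²) ⇒ (σ_K Y₁/M₂²)/√s₀ = Y₁`, and the printed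
statistic `√n (Kₙ − 1/M₂)/ŝₙ` coincides with `g(…)` as soon as `ŝₙ² > s₀/2`, which holds
eventually almost surely — so the difference tends to `0` almost surely, hence in probability,
and `tendstoInDistribution_of_tendstoInMeasure_sub` transfers the limit.  This completes the
error bars of the three printed columns (observable: `…SelfNormalisedReweightingStudentisedCLT`;
acceptance: `…AllPairsAcceptanceRatioStudentisedCLT`; ESS: here).  Printed counterpart NAMED ONLY:
the delta method with plug-in variance (van der Vaart 1998 §3.1).  NEW WORK of the cell; no
definition is introduced.

## Content

* `measurable_kishFrac`, `measurable_kishStdErr` — measurability bookkeeping;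
* `sqrt_div_pow_four` — `√(s/M⁴) = √s/M²` for `M > 0`;
* **`kishFrac_studentised_clt`** — THE THEOREM (`σ²_K > 0`; moments `p²/q, p³/q², p⁴/q³ ∈ L¹`).

NOT CLAIMED: the degenerate case `σ²_K = 0`; finite-sample calibration; any number of ours
re-scored.
-/

noncomputable section

namespace Summit.Ventures.LatticeQCDFlow.Scoring.CardConsistency

open MeasureTheory ProbabilityTheory Finset Real Filter
open scoped Topology Function

section Studentised

variable {Ω : Type*} [MeasurableSpace Ω] {P : Measure Ω} [IsProbabilityMeasure P]
variable {Ω' : Type*} [MeasurableSpace Ω'] {P' : Measure Ω'} [IsProbabilityMeasure P']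
variable {X : Type*} [MeasurableSpace X] {μ : Measure X} {p q : X → ℝ} {y : ℕ → Ω → X}
variable {Y₁ : Ω' → ℝ}

omit [IsProbabilityMeasure P] in
/-- The printed Kish fraction is measurable. [ours] -/
theorem measurable_kishFrac (hym : ∀ j, Measurable (y j)) {wt : X → ℝ} (hwtm : Measurable wt)
    (n : ℕ) : Measurable fun ω => kishESS (range n) (fun j => wt (y j ω)) / (n : ℝ) := by
  unfold kishESS
  exact (((Finset.measurable_sum _ fun j _ => hwtm.comp (hym j)).pow_const 2).div
    (Finset.measurable_sum _ fun j _ => (hwtm.comp (hym j)).pow_const 2)).div_const _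

omit [IsProbabilityMeasure P] in
/-- The plug-in squared standard error `ŝₙ²` is measurable. [ours] -/
theorem measurable_kishStdErr (hym : ∀ j, Measurable (y j)) {wt : X → ℝ} (hwtm : Measurable wt)
    (n : ℕ) : Measurable fun ω => (∑ i ∈ range n,
        (2 * (kishESS (range n) (fun j => wt (y j ω)) / (n : ℝ))
            * (wt (y i ω) / ((∑ j ∈ range n, wt (y j ω)) / (n : ℝ)))
          - (kishESS (range n) (fun j => wt (y j ω)) / (n : ℝ)) ^ 2
            * (wt (y i ω) / ((∑ j ∈ range n, wt (y j ω)) / (n : ℝ))) ^ 2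
          - kishESS (range n) (fun j => wt (y j ω)) / (n : ℝ)) ^ 2) / (n : ℝ) := by
  have hK := measurable_kishFrac hym hwtm n
  have hw : ∀ i, Measurable fun ω => wt (y i ω) / ((∑ j ∈ range n, wt (y j ω)) / (n : ℝ)) :=
    fun i => (hwtm.comp (hym i)).div
      ((Finset.measurable_sum _ fun j _ => hwtm.comp (hym j)).div_const _)
  refine Measurable.div_const (Finset.measurable_sum _ fun i _ => ?_) _
  exact ((((hK.const_mul 2).mul (hw i)).sub ((hK.pow_const 2).mul ((hw i).pow_const 2))).sub
    hK).pow_const 2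

/-- `√(s/M⁴) = √s/M²` for `M > 0`. [folklore] -/
theorem sqrt_div_pow_four {s M : ℝ} (hM : 0 < M) : Real.sqrt (s / M ^ 4) = Real.sqrt s / M ^ 2 := by
  rw [Real.sqrt_div' _ (by positivity), show (M ^ 4 : ℝ) = (M ^ 2) ^ 2 by ring,
    Real.sqrt_sq (by positivity)]

/-- **THE STUDENTISED CLT FOR THE PRINTED KISH ESS FRACTION (an asymptotically exact error bar
for the ESS column from the printed weights alone).**  One independent proposal stream `yᵢ`
(laws `ν = μ.withDensity q`); `p` measurable, integrable, `∫ p dμ = 1`; `q > 0` measurable;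
moments `p²/q, p³/q², p⁴/q³ ∈ L¹(μ)`; weights printed with ANY normalisation `w̃ = c·p/q`,
`c ≠ 0`; `M₂ = ∫ p²/q dμ`; POSITIVE `σ²_K = ∫ (2M₂w − w² − M₂)² dν`; `Y₁` standard normal.  With
`Kₙ = kishESS/n` the printed Kish fraction, `ŵᵢ = w̃ᵢ/W̄ₙ` and
`ŝₙ² = (1/n)Σ_{i<n}(2Kₙŵᵢ − Kₙ²ŵᵢ² − Kₙ)²`: `√n (Kₙ − 1/M₂)/ŝₙ ⇒ Y₁` in distribution. [ours] -/
theorem kishFrac_studentised_clt (hym : ∀ j, Measurable (y j)) (hind : iIndepFun y P)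
    (hlaw : ∀ j, Measure.map (y j) P = μ.withDensity fun z => ENNReal.ofReal (q z))
    (hpm : Measurable p) (hpi : Integrable p μ) (hp1 : ∫ z, p z ∂μ = 1) (hq0 : ∀ z, 0 < q z)
    (hqm : Measurable q) (hM2i : Integrable (fun z => p z ^ 2 / q z) μ)
    (hM3i : Integrable (fun z => p z ^ 3 / q z ^ 2) μ)
    (hM4i : Integrable (fun z => p z ^ 4 / q z ^ 3) μ) {wt : X → ℝ} {c : ℝ} (hc : c ≠ 0)
    (hwt : ∀ z, wt z = c * (p z / q z))
    (hσ : 0 < ∫ a, (2 * (∫ z, p z ^ 2 / q z ∂μ) * (p a / q a) - (p a / q a) ^ 2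
      - ∫ z, p z ^ 2 / q z ∂μ) ^ 2 ∂(μ.withDensity fun z => ENNReal.ofReal (q z)))
    (hY1 : HasLaw Y₁ (gaussianReal 0 1) P') :
    TendstoInDistribution (fun (n : ℕ) ω => Real.sqrt n *
        (kishESS (range n) (fun i => wt (y i ω)) / (n : ℝ) - (∫ z, p z ^ 2 / q z ∂μ)⁻¹)
        / Real.sqrt ((∑ i ∈ range n,
          (2 * (kishESS (range n) (fun j => wt (y j ω)) / (n : ℝ))
              * (wt (y i ω) / ((∑ j ∈ range n, wt (y j ω)) / (n : ℝ)))
            - (kishESS (range n) (fun j => wt (y j ω)) / (n : ℝ)) ^ 2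
              * (wt (y i ω) / ((∑ j ∈ range n, wt (y j ω)) / (n : ℝ))) ^ 2
            - kishESS (range n) (fun j => wt (y j ω)) / (n : ℝ)) ^ 2) / (n : ℝ)))
      atTop Y₁ (fun _ => P) P' := by
  haveI hν : IsProbabilityMeasure (μ.withDensity fun z => ENNReal.ofReal (q z)) :=
    hlaw 0 ▸ Measure.isProbabilityMeasure_map (hym 0).aemeasurable
  -- the CLT with limit `√s·Y₁/M²` and the plug-in standard error, before abbreviating
  have hYg := hasLaw_sqrt_mul_gaussian hY1 hσ.le
  have hclt := kishFrac_clt (P' := P') hym hind hlaw hpm hpi hp1 hq0 hqm hM2i hM4i hc hwt hYg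
  have hVae := kishStdErr_tendsto_ae hym hind hlaw hpm hpi hp1 hq0 hqm hM2i hM3i hM4i hc hwt
  obtain ⟨M, hM⟩ : ∃ M : ℝ, M = ∫ z, p z ^ 2 / q z ∂μ := ⟨_, rfl⟩
  rw [← hM] at hσ hclt hVae ⊢
  obtain ⟨s, hs⟩ : ∃ s : ℝ, s = ∫ a, (2 * M * (p a / q a) - (p a / q a) ^ 2 - M) ^ 2
      ∂(μ.withDensity fun z => ENNReal.ofReal (q z)) := ⟨_, rfl⟩
  rw [← hs] at hσ hclt hVae
  have hM0 : 0 < M :=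
    one_pos.trans_le (hM ▸ KishESSMedian.one_le_secondMoment_model hν hpm hpi hp1 hq0 hqm hM2i)
  have hs0 : 0 < s / M ^ 4 := by positivity
  have hwtm : Measurable wt := by
    have h : wt = fun z => c * (p z / q z) := funext hwt
    rw [h]
    exact (hpm.div hqm).const_mul c
  have hVm := fun n => measurable_kishStdErr (y := y) hym hwtm n
  have hV := tendstoInMeasure_of_tendsto_ae (fun n => (hVm n).aestronglyMeasurable) hVae
  -- Slutsky with `g(x, v) = x/√(max(v, s₀/2))`, `s₀ = s/M⁴`
  have hden : ∀ v : ℝ, Real.sqrt (max v (s / M ^ 4 / 2)) ≠ 0 := fun v =>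
    (Real.sqrt_pos.2 (lt_max_of_lt_right (half_pos hs0))).ne'
  have hgc : Continuous fun z : ℝ × ℝ => z.1 / Real.sqrt (max z.2 (s / M ^ 4 / 2)) :=
    continuous_fst.div (continuous_snd.max continuous_const).sqrt fun z => hden z.2
  have hsl := hclt.continuous_comp_prodMk_of_tendstoInMeasure_const hgc hV
    (fun n => (hVm n).aemeasurable)
  have elim : (fun ω' => Real.sqrt s * Y₁ ω' / M ^ 2 / Real.sqrt (max (s / M ^ 4) (s / M ^ 4 / 2)))
      = Y₁ := by
    funext ω'
    have hsq : Real.sqrt s ≠ 0 := (Real.sqrt_pos.2 hσ).ne'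
    rw [max_eq_left (by linarith), sqrt_div_pow_four hM0]
    field_simp
  rw [elim] at hsl
  -- the printed statistic agrees with the Slutsky statistic eventually, almost surely
  have hKm := fun n => measurable_kishFrac (y := y) hym hwtm n
  have hTm : ∀ n : ℕ, Measurable fun ω => Real.sqrt n *
      (kishESS (range n) (fun i => wt (y i ω)) / (n : ℝ) - M⁻¹) / Real.sqrt ((∑ i ∈ range n,
        (2 * (kishESS (range n) (fun j => wt (y j ω)) / (n : ℝ))
            * (wt (y i ω) / ((∑ j ∈ range n, wt (y j ω)) / (n : ℝ)))
          - (kishESS (range n) (fun j => wt (y j ω)) / (n : ℝ)) ^ 2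
            * (wt (y i ω) / ((∑ j ∈ range n, wt (y j ω)) / (n : ℝ))) ^ 2
          - kishESS (range n) (fun j => wt (y j ω)) / (n : ℝ)) ^ 2) / (n : ℝ)) := fun n =>
    (((hKm n).sub_const _).const_mul _).div (hVm n).sqrt
  refine tendstoInDistribution_of_tendstoInMeasure_sub (μ'' := P) (μ' := P') _ Y₁ hsl ?_
    (fun n => (hTm n).aemeasurable)
  refine tendstoInMeasure_of_tendsto_ae (fun n => ((hTm n).sub ((((hKm n).sub_const _).const_mul
    _).div ((hVm n).max measurable_const).sqrt)).aestronglyMeasurable) ?_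
  filter_upwards [hVae] with ω hVω
  refine (tendsto_const_nhds (x := (0 : ℝ))).congr' ?_
  filter_upwards [hVω.eventually_const_lt (half_lt_self hs0)] with n hn
  rw [Pi.sub_apply, Pi.sub_apply, max_eq_left hn.le, sub_self]

end Studentised

end Summit.Ventures.LatticeQCDFlow.Scoring.CardConsistency

end
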